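import Summits.QuantumFields.QCD.Theses.QuarksAsStableAction
import Summits.QuantumFields.QCD.Theorems.QuarksAsStableActionSmallHoppingDiamagnetismLift
import Summits.QuantumFields.QCD.Theorems.QuarksAsStableActionSmallHoppingDiamagnetismExpansion
import Summits.QuantumFields.QCD.Theorems.QuarksAsStableActionSmallHoppingDiamagnetismHead

/-!
# Small-hopping diamagnetism (stmt-QuantumFields-9738, route QuarksAsStableAction): the closing bound

`Summit.QuantumFields.QCD.Theorems.smallHoppingDiamagnetism_proof :
  Summit.QuantumFields.QCD.Theses.QuarksAsStableAction.SmallHoppingDiamagnetism` — with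
`m₀ = 2²⁶`, `c₁ = 1`, `C = 100`: for every `L ≥ 2`, every bare mass `m ≥ m₀` (`κ = (2m+8)⁻¹`) and
every `SU(3)` gauge field `U` on the four-torus of side `L`,
`|det D_AP[U, m]| ≤ exp(C L⁴ (8κ)^L - c₁ κ⁴ S_W(U)) · |det D_AP[1, m]|`
(antiperiodic Wilson–Dirac determinant, `r = 1`, full Wilson action of `U`).

Assembly of the hopping expansion (Montvay–Münster §5.1.3, Rothe §10): `D_W = (m+4)(1 - κH)`,
`log|det(1 - κH)| = -Re Σ_k κᵏ tr(Hᵏ)/k` (`‖H‖ ≤ 8`, `8κ < 1`; sibling `…Expansion`), the orders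
`k < L` run over closed = balanced words (`…Head`): `k ∈ {0,1,2,3,5}` vanish, the plaquette order
`k = 4` gives `≤ -2κ⁴ S_W` (spin trace `-8`), orders `6 ≤ k < L` give `≤ 4(256κ)⁶2⁻ᵏ S_W` (Stokes
bound `wordDefect ≤ |w|⁴ S_W`), the winding orders `k ≥ L` go into the slack `48 L⁴ (8κ)^L`
(`|tr Hᵏ| ≤ 12 L⁴ · 8ᵏ`); the comparison field `apLift 1` is flat on balanced words and
`S_W(apLift U) = S_W(U)` (`…Lift`).  For `L ≤ 4` the plaquette order is itself winding and the
term `κ⁴ S_W ≤ 36 L⁴ κ⁴ ≤ L⁴ (8κ)^L` is paid from the slack.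

This is a SUPPORT item (first rung under the crux `CriticalLineDiamagnetism`); no crux, rung or
summit statement is proved here, and nothing about `QCD` / the Yang–Mills mass gap follows.
-/

noncomputable section

namespace Summit.QuantumFields.QCD.Theorems

open Literature.Probability.LatticeModels Literature.MathematicalPhysics.QuantumLattice
  Literature.MathematicalPhysics.QuantumFieldTheory Matrix

namespace SmallHopping

variable {L : ℕ} [NeZero L]

/-- `8 (256 κ)⁶ ≤ κ⁴` once `κ ≤ 2⁻²⁷`. -/
theorem eight_mul_pow_six_le {κ : ℝ} (hκ0 : 0 ≤ κ) (hκ1 : κ * 2 ^ 27 ≤ 1) :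
    8 * (κ * 256) ^ 6 ≤ κ ^ 4 := by
  have h1 : (κ * 2 ^ 27) ^ 2 ≤ 1 := pow_le_one₀ (by positivity) hκ1
  have h2 : 0 ≤ κ ^ 4 := by positivity
  calc 8 * (κ * 256) ^ 6 = κ ^ 4 * (κ * 2 ^ 27) ^ 2 / 8 := by ring
    _ ≤ κ ^ 4 * 1 / 8 := by gcongr
    _ ≤ κ ^ 4 := by linarith

/-- **The hopping expansion bound, logarithmic form.**  For `2 ≤ L`, `0 < κ ≤ 2⁻²⁷` and every
`SU(3)` gauge field `U` on the four-torus of side `L`: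
`log|det(1 - κ H_{apLift U})| - log|det(1 - κ H_{apLift 1})| ≤ 100 L⁴ (8κ)^L - κ⁴ S_W(U)`. -/
theorem log_norm_det_apLift_sub_le (hL : 2 ≤ L)
    (U : GaugeConfig 4 L (Matrix.specialUnitaryGroup (Fin 3) ℂ))
    {κ : ℝ} (hκ0 : 0 < κ) (hκ1 : κ * 2 ^ 27 ≤ 1) :
    Real.log ‖((1 : Matrix _ _ ℂ) -
          (κ : ℂ) • hopMatrix (unitaryFundamentalRep (Fin 3) ℂ) (apLift U)).det‖ -
        Real.log ‖((1 : Matrix _ _ ℂ) - (κ : ℂ) • hopMatrix (unitaryFundamentalRep (Fin 3) ℂ)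
          (apLift (1 : GaugeConfig 4 L (Matrix.specialUnitaryGroup (Fin 3) ℂ)))).det‖ ≤
      100 * (L : ℝ) ^ 4 * (κ * 8) ^ L - κ ^ 4 * wilsonAction (fundamentalRep (Fin 3)) U := by
  have hρ : ∀ g, unitaryFundamentalRep (Fin 3) ℂ g ∈ Matrix.unitaryGroup (Fin 3) ℂ := fun g => g.2
  -- numerics
  have hκ8 : κ * 8 < 1 := by nlinarith
  have hκ8' : κ * 8 ≤ 1 / 2 := by nlinarith
  have hκ256 : κ * 256 ≤ 1 := by nlinarith
  have hsmall := eight_mul_pow_six_le hκ0.le hκ1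
  have hLpos : 0 < L := by omega
  have hLr : (1 : ℝ) ≤ L := by exact_mod_cast hLpos
  -- the three analytic inputs
  have hflat : ∀ (x : TorusSite 4 L) (w : List Letter), balanced w = true →
      hol (apLift (1 : GaugeConfig 4 L (Matrix.specialUnitaryGroup (Fin 3) ℂ))) x w = 1 :=
    fun x w hw => hol_apLift_one x w hw
  have hsplit := log_norm_det_sub_eq (unitaryFundamentalRep (Fin 3) ℂ) hρ (apLift U)
    (apLift (1 : GaugeConfig 4 L (Matrix.specialUnitaryGroup (Fin 3) ℂ))) hκ0.le hκ8 L
  have hhead := head_le (unitaryFundamentalRep (Fin 3) ℂ) hρ (apLift U)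
    (apLift (1 : GaugeConfig 4 L (Matrix.specialUnitaryGroup (Fin 3) ℂ))) hflat hκ0.le hκ256
  have htail := norm_tsum_tail_sub_le (unitaryFundamentalRep (Fin 3) ℂ) hρ (apLift U)
    (apLift (1 : GaugeConfig 4 L (Matrix.specialUnitaryGroup (Fin 3) ℂ))) hκ0.le hκ8 hLpos
  rw [hsplit]
  -- abbreviations
  set S := wilsonAction (unitaryFundamentalRep (Fin 3) ℂ) (apLift U) with hSdef
  set T := ∑' k : ℕ, ((κ : ℂ) ^ (k + L) *
      (hopMatrix (unitaryFundamentalRep (Fin 3) ℂ) (apLift U) ^ (k + L)).trace / (k + L : ℕ) -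
    (κ : ℂ) ^ (k + L) * (hopMatrix (unitaryFundamentalRep (Fin 3) ℂ)
      (apLift (1 : GaugeConfig 4 L (Matrix.specialUnitaryGroup (Fin 3) ℂ))) ^ (k + L)).trace /
        (k + L : ℕ)) with hTdef
  have hS : S = wilsonAction (fundamentalRep (Fin 3)) U := wilsonAction_apLift U
  have hS0 : 0 ≤ S := wilsonAction_nonneg' _ hρ _
  have hSle : S ≤ 36 * (L : ℝ) ^ 4 := by
    have h := wilsonAction_le_card (unitaryFundamentalRep (Fin 3) ℂ) hρ (apLift U)
    calc S ≤ 2 * (3 : ℕ) * (6 * (L : ℝ) ^ 4) := h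
      _ = 36 * (L : ℝ) ^ 4 := by push_cast; ring
  have hcard : (Fintype.card (TorusSite 4 L × Fin 3 × Fin 4) : ℝ) = 12 * (L : ℝ) ^ 4 := by
    rw [card_index]; push_cast; ring
  have hr0 : 0 ≤ (κ * 8) ^ L := by positivity
  have hL4r : 0 ≤ (L : ℝ) ^ 4 * (κ * 8) ^ L := by positivity
  -- the tail
  have hL0 : (L : ℝ) ≠ 0 := Nat.cast_ne_zero.mpr (NeZero.ne L)
  have htail' : ‖T‖ ≤ 48 * (L : ℝ) ^ 4 * (κ * 8) ^ L := by
    refine htail.trans ?_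
    rw [hcard, div_le_iff₀ (by linarith : (0 : ℝ) < 1 - κ * 8),
      show 2 * (12 * (L : ℝ) ^ 4) / L = 24 * (L : ℝ) ^ 3 by field_simp; ring]
    have h3 : (L : ℝ) ^ 3 ≤ (L : ℝ) ^ 4 := pow_le_pow_right₀ hLr (by norm_num)
    nlinarith [mul_nonneg (sub_nonneg.mpr h3) hr0, hL4r, mul_nonneg (sub_nonneg.mpr hκ8') hL4r]
  have hre : -T.re ≤ ‖T‖ := (neg_le_abs _).trans (Complex.abs_re_le_norm _)
  rw [← hS]
  by_cases h4 : 4 < L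
  · rw [if_pos h4] at hhead
    have hh2 : (-2 * κ ^ 4 + 8 * (κ * 256) ^ 6) * S ≤ -κ ^ 4 * S :=
      mul_le_mul_of_nonneg_right (by linarith) hS0
    linarith
  · rw [if_neg h4, zero_add] at hhead
    have hL4 : L ≤ 4 := by omega
    have hpow : (κ * 8) ^ 4 ≤ (κ * 8) ^ L :=
      pow_le_pow_of_le_one (by positivity) (by linarith) hL4
    have hh2 : 8 * (κ * 256) ^ 6 * S ≤ κ ^ 4 * S := mul_le_mul_of_nonneg_right hsmall hS0
    have hκS : κ ^ 4 * S ≤ (L : ℝ) ^ 4 * (κ * 8) ^ L := by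
      calc κ ^ 4 * S ≤ κ ^ 4 * (36 * (L : ℝ) ^ 4) := by gcongr
        _ = 36 / 4096 * (L : ℝ) ^ 4 * (κ * 8) ^ 4 := by ring
        _ ≤ 36 / 4096 * (L : ℝ) ^ 4 * (κ * 8) ^ L := by gcongr
        _ ≤ (L : ℝ) ^ 4 * (κ * 8) ^ L := by nlinarith
    linarith

end SmallHopping

open SmallHopping in
/-- **Small-hopping diamagnetism** (closes stmt-QuantumFields-9738, route QuarksAsStableAction):
with `m₀ = 2²⁶`, `c₁ = 1`, `C = 100`, for every `L ≥ 2`, `m ≥ m₀` and every `SU(3)` field `U`,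
`|det D_AP[U, m]| ≤ exp(C L⁴ (4/(m+4))^L - c₁ (2m+8)⁻⁴ S_W(U)) · |det D_AP[1, m]|`. -/
theorem smallHoppingDiamagnetism_proof :
    Summit.QuantumFields.QCD.Theses.QuarksAsStableAction.SmallHoppingDiamagnetism := by
  refine ⟨2 ^ 26, 1, 100, by norm_num, by norm_num, ?_⟩
  intro L _ hL apDet m hm U
  have hρ : ∀ g, unitaryFundamentalRep (Fin 3) ℂ g ∈ Matrix.unitaryGroup (Fin 3) ℂ := fun g => g.2
  have hm0 : 0 < m := lt_of_lt_of_le (by norm_num) hm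
  have hm4 : m + 4 ≠ 0 := by linarith
  have hκ0 : 0 < (2 * m + 8)⁻¹ := by positivity
  have hκ1 : (2 * m + 8)⁻¹ * 2 ^ 27 ≤ 1 := by
    rw [inv_mul_le_iff₀ (by positivity)]; linarith
  have hκ8 : (2 * m + 8)⁻¹ * 8 < 1 := by nlinarith
  have h2m8 : (2 * m + 8 : ℝ) ≠ 0 := ne_of_gt (by linarith)
  have h8κ : (4 / (m + 4) : ℝ) = (2 * m + 8)⁻¹ * 8 := by
    field_simp; ring
  show ‖(wilsonDirac (unitaryFundamentalRep (Fin 3) ℂ) (apLift U) m 1).det‖ ≤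
    Real.exp (100 * (L : ℝ) ^ 4 * (4 / (m + 4)) ^ L -
        1 * ((2 * m + 8)⁻¹) ^ 4 * wilsonAction (fundamentalRep (Fin 3)) U) *
      ‖(wilsonDirac (unitaryFundamentalRep (Fin 3) ℂ)
        (apLift (1 : GaugeConfig 4 L (Matrix.specialUnitaryGroup (Fin 3) ℂ))) m 1).det‖
  rw [det_wilsonDirac _ _ m hm4, det_wilsonDirac _ _ m hm4, norm_mul, norm_mul, h8κ, one_mul]
  have hmain := log_norm_det_apLift_sub_le hL U hκ0 hκ1
  obtain ⟨hneV, -, -⟩ := logDet_hopMatrix (unitaryFundamentalRep (Fin 3) ℂ) hρ (apLift U) hκ0.le hκ8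
  obtain ⟨hne1, -, -⟩ := logDet_hopMatrix (unitaryFundamentalRep (Fin 3) ℂ) hρ
    (apLift (1 : GaugeConfig 4 L (Matrix.specialUnitaryGroup (Fin 3) ℂ))) hκ0.le hκ8
  have hposV := norm_pos_iff.mpr hneV
  have hpos1 := norm_pos_iff.mpr hne1
  have key : ‖((1 : Matrix _ _ ℂ) - (((2 * m + 8)⁻¹ : ℝ) : ℂ) •
        hopMatrix (unitaryFundamentalRep (Fin 3) ℂ) (apLift U)).det‖ ≤
      Real.exp (100 * (L : ℝ) ^ 4 * ((2 * m + 8)⁻¹ * 8) ^ L -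
          ((2 * m + 8)⁻¹) ^ 4 * wilsonAction (fundamentalRep (Fin 3)) U) *
        ‖((1 : Matrix _ _ ℂ) - (((2 * m + 8)⁻¹ : ℝ) : ℂ) • hopMatrix (unitaryFundamentalRep (Fin 3) ℂ)
          (apLift (1 : GaugeConfig 4 L (Matrix.specialUnitaryGroup (Fin 3) ℂ)))).det‖ := by
    have h := Real.exp_le_exp.mpr (sub_le_iff_le_add.mp hmain)
    rwa [Real.exp_log hposV, Real.exp_add, Real.exp_log hpos1] at h
  calc _ ≤ ‖((m + 4 : ℝ) : ℂ) ^ Fintype.card (TorusSite 4 L × Fin 3 × Fin 4)‖ *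
        (Real.exp (100 * (L : ℝ) ^ 4 * ((2 * m + 8)⁻¹ * 8) ^ L -
            ((2 * m + 8)⁻¹) ^ 4 * wilsonAction (fundamentalRep (Fin 3)) U) *
          ‖((1 : Matrix _ _ ℂ) - (((2 * m + 8)⁻¹ : ℝ) : ℂ) •
            hopMatrix (unitaryFundamentalRep (Fin 3) ℂ)
              (apLift (1 : GaugeConfig 4 L (Matrix.specialUnitaryGroup (Fin 3) ℂ)))).det‖) :=
        mul_le_mul_of_nonneg_left key (norm_nonneg _)
    _ = _ := by ring

end Summit.QuantumFields.QCD.Theorems
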